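import Literature.AlgebraicGeometry.GroupSchemes.StrictBirationalGroupLaw
import Literature.AlgebraicGeometry.RationalMaps.DomainOfAgreement
import HarnessLib

/-!
# Artin's three-section chart of the gluing step: `(x, s) ∈ dom (𝒳 ×_S 𝒳 ⤏ V ∪ V·s)`
# (Artin, *Néron models*, §2, Lemma 2.4 and «replacing `V′` by `V′ ∪ V′_s` increases `W`»)

Topic `Literature/AlgebraicGeometry/GroupSchemes`, namespace `Literature.AlgebraicGeometry.GroupSchemes`.  THEOREMS
ONLY (no definition, no named fact, no instance, no `sorry`).  Cell `hodgecm-mathlib`, road W (r₀), (W1) step (G2c)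
«StageStep, measure increase», piece (G2c-pt) = the CHART, layer C1 (conditional on its definedness inputs).

Setting.  `L = (dom, mul)` a birational group law on `𝒳 → S`, `L′ = (dom′, mul′)` one on the stage `𝒱 → S`,
`j : 𝒳 → 𝒱` intertwining them through `φ : dom → dom′` (`hφ₁`, `hφ₂`), a section `s` of `𝒳 → S` with slice
`σ′ = (𝟙, s′ ∘ π)` of `s′ = j ∘ s` on `𝒱` (`hσ'1`, `hσ'2`), the translate chart `ρ = mul′ ∘ e : A ↪ 𝒱`, `a ↦ a·s′`
(`he`, `hρ`, `hρS`; ★ `BirationalGroupLaw.exists_rightTranslate'`), and the glued stage `𝒲 = 𝒱 ∪_A 𝒱` with its two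
charts `i₁, i₂ : 𝒱 → 𝒲`, `ρ ≫ i₁ = A.ι ≫ i₂` (`hglue`; ★ `exists_selfGluing`), so that `i₂(v)` «is» `v·s′`.  An
auxiliary section `y` of `𝒱` (e.g. `j ∘ y₀` for a section `y₀` of `𝒳`) and the PARTIAL section `u = s′·y` of `𝒱` over the open
`S₀ ⊆ S` where
`(s′, y) ∈ dom′` (witness `qu : S₀ → dom′`, `hqu₁`, `hqu₂`; `u := qu ≫ mul′`).

THE CHART ([Artin1986NeronModels] p. 222, Lemma 2.4, with the auxiliary third section of the last paragraph): on the
open `U = {w = (a, b) over S₀ : (jb, y) ∈ dom′, (ja, jb·y) ∈ dom′, (ja·(jb·y), u) ∈ im Ψ′}` of `𝒳 ×_S 𝒳` the morphism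
`g(w) = i₂(pr₁ Ψ′⁻¹(ja·(jb·y), u))` — right division by `u` through the right shear `Ψ′ : (c, x) ↦ (c x, x)` of `L′`,
an open immersion; informally `g(a, b) = ((a (b y)) u⁻¹)·s′ = a b`.  Since `u` enters only as the coordinate
`u(π w)`, it needs to be defined on `S₀ ∋ π w` only: NO translate by `u`, no base change, the base `S` arbitrary.
CONCLUSION: for every `T₀`-valued point `τ` of `𝒳` over `S₀` with `(j τ, u(π τ)) ∈ dom′` (`q`, `hq₁`, `hq₂`) — e.g.
the bad point `x` of the step — the slice point `σ_s(τ(x₀)) = (τ x₀, s)` lies in the domain of definition of the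
rational map `(dom, mul ≫ j ≫ i₁) : 𝒳 ×_S 𝒳 ⤏ 𝒲` (the «measure» of the new stage, ★ `measure_lt_measure_comp_of_mem`),
PROVIDED one `T₁`-valued configuration `hne` exists over which all eight products below are defined (discharged from
strictness in layer C1b).  AGREEMENT with `mul ≫ j ≫ i₁` on the open `W ⊆ U ∩ dom` where `d = pr₁ Ψ′⁻¹(…) ∈ A`,
`(d·s′, y) ∈ dom′`, `(j(ab), y) ∈ dom′`: `i₂ d = i₁ (d·s′)` (`hglue`) and `d·s′ = j(ab)` by the associativity of `L′`
TWICE — `(d s′) y = d (s′ y) = d u = a(by)` and `(ja jb) y = ja (jb y) = a(by)` — and right cancellation by `y`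
(`Ψ′` mono); then ★ `RationalMap.mem_domain_of_agree_on_nonempty_open` (`𝒳 ×_S 𝒳` preirreducible).
HC_CM is proved only modulo the 7 printed citations until rung 0 closes; banked leaf, no floor change.

## References
* [Artin1986NeronModels] M. Artin, *Néron models*, in Cornell–Silverman, *Arithmetic Geometry* (1986), §2, Lemma 2.4
  and the proof of Thm. (1.12), p. 222–223.
* [EdixhovenRomagny] B. Edixhoven, M. Romagny, *Group schemes out of birational group laws, Néron models*, Panor.
  Synthèses 47 (2015), Def. 3.4 (3), Lemmas 3.19–3.21.
* [GortzWedhorn2020] U. Görtz, T. Wedhorn, *Algebraic Geometry I*, 2nd ed. (2020), §(9.6).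
-/

noncomputable section

set_option backward.isDefEq.respectTransparency false

universe u

namespace Literature.AlgebraicGeometry.GroupSchemes

open CategoryTheory Limits _root_.AlgebraicGeometry MonoidalCategory CartesianMonoidalCategory TopologicalSpace
open Literature.AlgebraicGeometry.RationalMaps

/-! ## §1. Plumbing -/

/-- A morphism whose image lies in an open factors through it. [folklore] -/
private theorem exists_lift_opens {X T : Scheme.{u}} (O : X.Opens) (g : T ⟶ X) (h : ∀ t : T, g.base t ∈ O) :
    ∃ l : T ⟶ (O : Scheme.{u}), l ≫ O.ι = g := by
  refine ⟨IsOpenImmersion.lift O.ι g ?_, IsOpenImmersion.lift_fac _ _ _⟩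
  rintro _ ⟨t, rfl⟩
  rw [Scheme.Opens.range_ι]
  exact h t

/-- A morphism whose image lies in the range of an open immersion factors through it. [folklore] -/
private theorem exists_lift_imm {X Y T : Scheme.{u}} (f : X ⟶ Y) [IsOpenImmersion f] (g : T ⟶ Y)
    (h : ∀ t : T, g.base t ∈ Set.range f.base) : ∃ l : T ⟶ X, l ≫ f = g :=
  ⟨IsOpenImmersion.lift f g (by rintro _ ⟨t, rfl⟩; exact h t), IsOpenImmersion.lift_fac _ _ _⟩

/-- Evaluation of a composition identity at a point. [folklore] -/
private theorem base_comp_apply {X Y Z : Scheme.{u}} {f : X ⟶ Y} {g : Y ⟶ Z} {h : X ⟶ Z} (e : f ≫ g = h) (x : X) :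
    g.base (f.base x) = h.base x := by
  rw [← e, Scheme.Hom.comp_base, TopCat.coe_comp, Function.comp_apply]

/-! ## §2. The chart -/

variable {S : Scheme.{u}} {𝒳 𝒱 𝒲 : Over S} (L : BirationalGroupLaw 𝒳) (L' : BirationalGroupLaw 𝒱) (j : 𝒳 ⟶ 𝒱)
  [PreirreducibleSpace ↑(𝒳 ⊗ 𝒳).left]
  (φ : (L.dom : Scheme.{u}) ⟶ (L'.dom : Scheme.{u}))
  (hφ₁ : φ ≫ L'.dom.ι = L.dom.ι ≫ (j ⊗ₘ j).left) (hφ₂ : φ ≫ L'.mul = L.mul ≫ j.left)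
  (i₁ i₂ : 𝒱 ⟶ 𝒲)
  (s : S ⟶ 𝒳.left) (hs : s ≫ 𝒳.hom = 𝟙 S)
  (σ' : 𝒱.left ⟶ (𝒱 ⊗ 𝒱).left) (hσ'1 : σ' ≫ (fst 𝒱 𝒱).left = 𝟙 _)
  (hσ'2 : σ' ≫ (snd 𝒱 𝒱).left = 𝒱.hom ≫ s ≫ j.left)
  {A : 𝒱.left.Opens} (e : (A : Scheme.{u}) ⟶ (L'.dom : Scheme.{u})) (ρ : (A : Scheme.{u}) ⟶ 𝒱.left)
  (he : e ≫ L'.dom.ι = A.ι ≫ σ') (hρ : ρ = e ≫ L'.mul) (hρS : ρ ≫ 𝒱.hom = A.ι ≫ 𝒱.hom)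
  (hglue : ρ ≫ i₁.left = A.ι ≫ i₂.left)
  (y : S ⟶ 𝒱.left) (hy : y ≫ 𝒱.hom = 𝟙 S)
  (S₀ : S.Opens) (qu : (S₀ : Scheme.{u}) ⟶ (L'.dom : Scheme.{u}))
  (hqu₁ : qu ≫ L'.dom.ι ≫ (fst 𝒱 𝒱).left = S₀.ι ≫ s ≫ j.left)
  (hqu₂ : qu ≫ L'.dom.ι ≫ (snd 𝒱 𝒱).left = S₀.ι ≫ y)

include hφ₁ hφ₂ hs hσ'1 hσ'2 he hρ hρS hglue hy hqu₁ hqu₂ in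
/-- **Artin's three-section chart of the gluing step** ([Artin1986NeronModels] §2, p. 222: Lemma 2.4 «the law of
composition on `V` induces one on `V′`» together with «replacing `V′` by `V′ ∪ V′_s` … increases `W`», made explicit
with the auxiliary section of the last paragraph).  In the setting of the module docstring: if `τ` is a `T₀`-valued
point of `𝒳` over `S₀` with `(j τ, u(π τ)) ∈ dom′` (witness `q`), and if ONE `T₁`-valued configuration with all eight
products defined exists (`hne`: a point `a₁` over `S₀` with `(j a₁, u) ∈ dom′`, `(a₁, s) ∈ dom`, `j a₁ ∈ A`,
`(j (a₁·s), y) ∈ dom′`), then for every `x₀ : T₀` the slice point `σ_s(τ x₀) = (τ x₀, s(π τ x₀))` of `𝒳 ×_S 𝒳` lies in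
the domain of definition of the rational map `(dom, mul ≫ j ≫ i₁) : 𝒳 ×_S 𝒳 ⤏ 𝒲`.  (Chart
`g(a,b) = i₂ (pr₁ Ψ′⁻¹ (ja·(jb·y), u)) = «((a(by))u⁻¹)·s′»`; agreement `d·s′ = j(ab)` by `L′.assoc` twice and right
cancellation by `y`; then ★ `RationalMap.mem_domain_of_agree_on_nonempty_open`.)
[cite: Artin1986NeronModels, §2, Lemma 2.4 and p. 222 «this increases W»] [cite: EdixhovenRomagny, Def. 3.4 (3), Lemmas 3.19–3.21]
[cite: GortzWedhorn2020, §(9.6) Def. 9.26–Prop. 9.27] -/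
theorem BirationalGroupLaw.sectionSlice_mem_domain_comp_of_chart
    {T₀ : Scheme.{u}} (τ : T₀ ⟶ 𝒳.left) (τS : T₀ ⟶ (S₀ : Scheme.{u})) (hτS : τS ≫ S₀.ι = τ ≫ 𝒳.hom)
    (q : T₀ ⟶ (L'.dom : Scheme.{u})) (hq₁ : q ≫ L'.dom.ι ≫ (fst 𝒱 𝒱).left = τ ≫ j.left)
    (hq₂ : q ≫ L'.dom.ι ≫ (snd 𝒱 𝒱).left = τS ≫ qu ≫ L'.mul)
    (hne : ∃ (T₁ : Scheme.{u}) (_ : Nonempty T₁) (τ₁ : T₁ ⟶ 𝒳.left) (τ₁S : T₁ ⟶ (S₀ : Scheme.{u}))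
        (q' qy : T₁ ⟶ (L'.dom : Scheme.{u})) (qa : T₁ ⟶ (L.dom : Scheme.{u})) (qA : T₁ ⟶ (A : Scheme.{u})),
      τ₁S ≫ S₀.ι = τ₁ ≫ 𝒳.hom ∧
      q' ≫ L'.dom.ι ≫ (fst 𝒱 𝒱).left = τ₁ ≫ j.left ∧ q' ≫ L'.dom.ι ≫ (snd 𝒱 𝒱).left = τ₁S ≫ qu ≫ L'.mul ∧
      qa ≫ L.dom.ι ≫ (fst 𝒳 𝒳).left = τ₁ ∧ qa ≫ L.dom.ι ≫ (snd 𝒳 𝒳).left = τ₁ ≫ 𝒳.hom ≫ s ∧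
      qA ≫ A.ι = τ₁ ≫ j.left ∧
      qy ≫ L'.dom.ι ≫ (fst 𝒱 𝒱).left = qa ≫ L.mul ≫ j.left ∧ qy ≫ L'.dom.ι ≫ (snd 𝒱 𝒱).left = τ₁ ≫ 𝒳.hom ≫ y)
    (x₀ : T₀) :
    (lift (𝟙 𝒳) (Over.homMk (𝒳.hom ≫ s) (by rw [Category.assoc, hs, Category.comp_id]) : 𝒳 ⟶ 𝒳)).left.base
        (τ.base x₀) ∈
      (Scheme.PartialMap.toRationalMap
        (⟨L.dom, L.dense_dom.dense, L.mul ≫ (j ≫ i₁).left⟩ : (𝒳 ⊗ 𝒳).left.PartialMap 𝒲.left)).domain := by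
  -- ### notation and coordinate helpers
  have hextX : ∀ {T : Scheme.{u}} (f g : T ⟶ (𝒳 ⊗ 𝒳).left),
      f ≫ (fst 𝒳 𝒳).left = g ≫ (fst 𝒳 𝒳).left → f ≫ (snd 𝒳 𝒳).left = g ≫ (snd 𝒳 𝒳).left → f = g :=
    fun f g h1 h2 => pullback.hom_ext h1 h2
  have hextV : ∀ {T : Scheme.{u}} (f g : T ⟶ (𝒱 ⊗ 𝒱).left),
      f ≫ (fst 𝒱 𝒱).left = g ≫ (fst 𝒱 𝒱).left → f ≫ (snd 𝒱 𝒱).left = g ≫ (snd 𝒱 𝒱).left → f = g :=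
    fun f g h1 h2 => pullback.hom_ext h1 h2
  have hfstS : (fst 𝒳 𝒳).left ≫ 𝒳.hom = (𝒳 ⊗ 𝒳).hom := Over.w (fst 𝒳 𝒳)
  have hsndS : (snd 𝒳 𝒳).left ≫ 𝒳.hom = (𝒳 ⊗ 𝒳).hom := Over.w (snd 𝒳 𝒳)
  have hfstS' : (fst 𝒱 𝒱).left ≫ 𝒱.hom = (𝒱 ⊗ 𝒱).hom := Over.w (fst 𝒱 𝒱)
  have hsndS' : (snd 𝒱 𝒱).left ≫ 𝒱.hom = (𝒱 ⊗ 𝒱).hom := Over.w (snd 𝒱 𝒱)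
  have hjS : j.left ≫ 𝒱.hom = 𝒳.hom := Over.w j
  have hjj1 : (j ⊗ₘ j).left ≫ (fst 𝒱 𝒱).left = (fst 𝒳 𝒳).left ≫ j.left :=
    congrArg CommaMorphism.left (tensorHom_fst j j)
  have hjj2 : (j ⊗ₘ j).left ≫ (snd 𝒱 𝒱).left = (snd 𝒳 𝒳).left ≫ j.left :=
    congrArg CommaMorphism.left (tensorHom_snd j j)
  -- the slice `σX = (𝟙, s ∘ π)` of `s` on `𝒳`
  set σX : 𝒳 ⟶ 𝒳 ⊗ 𝒳 := lift (𝟙 𝒳) (Over.homMk (𝒳.hom ≫ s) (by rw [Category.assoc, hs, Category.comp_id]))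
    with hσXdef
  have hσX1 : σX.left ≫ (fst 𝒳 𝒳).left = 𝟙 _ := by
    change (σX ≫ fst 𝒳 𝒳).left = _; rw [hσXdef, lift_fst]; rfl
  have hσX2 : σX.left ≫ (snd 𝒳 𝒳).left = 𝒳.hom ≫ s := by
    change (σX ≫ snd 𝒳 𝒳).left = _; rw [hσXdef, lift_snd]; rfl
  have hσXS : σX.left ≫ (𝒳 ⊗ 𝒳).hom = 𝒳.hom := Over.w σX
  -- the right shear `Ψ′` of `L′`, retyped on `↑dom′`
  let Ψ' : (L'.dom : Scheme.{u}) ⟶ (𝒱 ⊗ 𝒱).left := L'.shearRight.left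
  haveI hΨo : IsOpenImmersion Ψ' := L'.isOpenImmersion_shearRight
  have hΨ1 : Ψ' ≫ (fst 𝒱 𝒱).left = L'.mul :=
    congrArg CommaMorphism.left (LawData.shearRight_fst 𝒱 L'.dom L'.mul L'.mul_comp)
  have hΨ2 : Ψ' ≫ (snd 𝒱 𝒱).left = L'.dom.ι ≫ (snd 𝒱 𝒱).left :=
    congrArg CommaMorphism.left (LawData.shearRight_snd 𝒱 L'.dom L'.mul L'.mul_comp)
  -- the partial section `u = s′·y` on `S₀`
  have huι : qu ≫ L'.dom.ι ≫ (𝒱 ⊗ 𝒱).hom = S₀.ι := by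
    rw [← hfstS', reassoc_of% hqu₁, hjS, hs, Category.comp_id]
  have hu : qu ≫ L'.mul ≫ 𝒱.hom = S₀.ι := by rw [L'.mul_comp, huι]
  -- ### Step A: `β₁ = (jb, y π) : 𝒳 ×_S 𝒳 → 𝒱 ×_S 𝒱`, `U₁ = β₁⁻¹ dom′ ∩ π⁻¹ S₀`
  obtain ⟨β₁, hβ₁1, hβ₁2⟩ : ∃ β₁ : (𝒳 ⊗ 𝒳).left ⟶ (𝒱 ⊗ 𝒱).left,
      β₁ ≫ (fst 𝒱 𝒱).left = (snd 𝒳 𝒳).left ≫ j.left ∧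
      β₁ ≫ (snd 𝒱 𝒱).left = (𝒳 ⊗ 𝒳).hom ≫ y := by
    have w : ((snd 𝒳 𝒳).left ≫ j.left) ≫ 𝒱.hom = ((𝒳 ⊗ 𝒳).hom ≫ y) ≫ 𝒱.hom := by
      simp only [Category.assoc]
      rw [hjS, hsndS, hy, Category.comp_id]
    exact ⟨pullback.lift _ _ w, pullback.lift_fst _ _ _, pullback.lift_snd _ _ _⟩
  have hβ₁S : β₁ ≫ (𝒱 ⊗ 𝒱).hom = (𝒳 ⊗ 𝒳).hom := by
    rw [← hfstS', reassoc_of% hβ₁1, hjS, hsndS]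
  set U₁ : (𝒳 ⊗ 𝒳).left.Opens := β₁ ⁻¹ᵁ L'.dom ⊓ (𝒳 ⊗ 𝒳).hom ⁻¹ᵁ S₀ with hU₁def
  obtain ⟨q₁, hq₁'⟩ : ∃ q₁ : (U₁ : Scheme.{u}) ⟶ (L'.dom : Scheme.{u}), q₁ ≫ L'.dom.ι = U₁.ι ≫ β₁ :=
    exists_lift_opens L'.dom (U₁.ι ≫ β₁) fun w => w.2.1
  let πS : (U₁ : Scheme.{u}) ⟶ (S₀ : Scheme.{u}) := (𝒳 ⊗ 𝒳).hom.resLE S₀ U₁ inf_le_right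
  have hπS : πS ≫ S₀.ι = U₁.ι ≫ (𝒳 ⊗ 𝒳).hom := Scheme.Hom.resLE_comp_ι _ _
  -- ### Step B: `β₂ = (ja, jb·y) : U₁ → 𝒱 ×_S 𝒱`, `U₂ = β₂⁻¹ dom′`
  obtain ⟨β₂, hβ₂1, hβ₂2⟩ : ∃ β₂ : (U₁ : Scheme.{u}) ⟶ (𝒱 ⊗ 𝒱).left,
      β₂ ≫ (fst 𝒱 𝒱).left = U₁.ι ≫ (fst 𝒳 𝒳).left ≫ j.left ∧ β₂ ≫ (snd 𝒱 𝒱).left = q₁ ≫ L'.mul := by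
    have w : (U₁.ι ≫ (fst 𝒳 𝒳).left ≫ j.left) ≫ 𝒱.hom = (q₁ ≫ L'.mul) ≫ 𝒱.hom := by
      simp only [Category.assoc]
      rw [hjS, hfstS, L'.mul_comp, reassoc_of% hq₁', hβ₁S]
    exact ⟨pullback.lift _ _ w, pullback.lift_fst _ _ _, pullback.lift_snd _ _ _⟩
  have hβ₂S : β₂ ≫ (𝒱 ⊗ 𝒱).hom = U₁.ι ≫ (𝒳 ⊗ 𝒳).hom := by
    rw [← hfstS', reassoc_of% hβ₂1, hjS, hfstS]
  set U₂ : (U₁ : Scheme.{u}).Opens := β₂ ⁻¹ᵁ L'.dom with hU₂def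
  obtain ⟨q₂, hq₂'⟩ : ∃ q₂ : (U₂ : Scheme.{u}) ⟶ (L'.dom : Scheme.{u}), q₂ ≫ L'.dom.ι = U₂.ι ≫ β₂ :=
    exists_lift_opens L'.dom (U₂.ι ≫ β₂) fun w => w.2
  -- ### Step C: `β₃ = (ja·(jb·y), u π) : U₂ → 𝒱 ×_S 𝒱`, `U₃ = β₃⁻¹ (im Ψ′)`, `θ = Ψ′⁻¹ ∘ β₃`, `d = pr₁ θ`
  obtain ⟨β₃, hβ₃1, hβ₃2⟩ : ∃ β₃ : (U₂ : Scheme.{u}) ⟶ (𝒱 ⊗ 𝒱).left,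
      β₃ ≫ (fst 𝒱 𝒱).left = q₂ ≫ L'.mul ∧ β₃ ≫ (snd 𝒱 𝒱).left = U₂.ι ≫ πS ≫ qu ≫ L'.mul := by
    have w : (q₂ ≫ L'.mul) ≫ 𝒱.hom = (U₂.ι ≫ πS ≫ qu ≫ L'.mul) ≫ 𝒱.hom := by
      simp only [Category.assoc]
      rw [L'.mul_comp, reassoc_of% hq₂', hβ₂S, huι, hπS]
    exact ⟨pullback.lift _ _ w, pullback.lift_fst _ _ _, pullback.lift_snd _ _ _⟩
  set U₃ : (U₂ : Scheme.{u}).Opens := β₃ ⁻¹ᵁ Ψ'.opensRange with hU₃def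
  obtain ⟨θ, hθ⟩ : ∃ θ : (U₃ : Scheme.{u}) ⟶ (L'.dom : Scheme.{u}), θ ≫ Ψ' = U₃.ι ≫ β₃ :=
    exists_lift_imm Ψ' (U₃.ι ≫ β₃) fun w => w.2
  have hθ1 : θ ≫ L'.mul = U₃.ι ≫ q₂ ≫ L'.mul := by
    have h := congrArg (· ≫ (fst 𝒱 𝒱).left) hθ
    simpa only [Category.assoc, hΨ1, hβ₃1] using h
  have hθ2 : θ ≫ L'.dom.ι ≫ (snd 𝒱 𝒱).left = U₃.ι ≫ U₂.ι ≫ πS ≫ qu ≫ L'.mul := by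
    rw [← hΨ2, reassoc_of% hθ, hβ₃2]
  -- the chart domain `χ : U₃ ↪ 𝒳 ×_S 𝒳` and `d : U₃ → 𝒱`
  obtain ⟨χ, hχ⟩ : ∃ χ : (U₃ : Scheme.{u}) ⟶ (𝒳 ⊗ 𝒳).left, χ = U₃.ι ≫ U₂.ι ≫ U₁.ι := ⟨_, rfl⟩
  haveI hχo : IsOpenImmersion χ := by rw [hχ]; infer_instance
  obtain ⟨d, hd⟩ : ∃ d : (U₃ : Scheme.{u}) ⟶ 𝒱.left, d = θ ≫ L'.dom.ι ≫ (fst 𝒱 𝒱).left := ⟨_, rfl⟩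
  have hdS : d ≫ 𝒱.hom = χ ≫ (𝒳 ⊗ 𝒳).hom := by
    rw [hd, hχ]
    simp only [Category.assoc]
    rw [hfstS', ← hsndS', reassoc_of% hθ2, hu, hπS]
  -- ### Step D: FACTORISATION — a `T`-point of `𝒳` over `S₀` with `(jτ, u πτ) ∈ dom′` gives a `T`-point of `U₃`
  have factor : ∀ {T : Scheme.{u}} (τ : T ⟶ 𝒳.left) (τS : T ⟶ (S₀ : Scheme.{u})) (_ : τS ≫ S₀.ι = τ ≫ 𝒳.hom)
      (q : T ⟶ (L'.dom : Scheme.{u})) (_ : q ≫ L'.dom.ι ≫ (fst 𝒱 𝒱).left = τ ≫ j.left)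
      (_ : q ≫ L'.dom.ι ≫ (snd 𝒱 𝒱).left = τS ≫ qu ≫ L'.mul),
      ∃ ℓ : T ⟶ (U₃ : Scheme.{u}), ℓ ≫ χ = τ ≫ σX.left ∧ ℓ ≫ θ = q ∧
        ℓ ≫ U₃.ι ≫ U₂.ι ≫ q₁ = τS ≫ qu ∧ ℓ ≫ U₃.ι ≫ q₂ = q := by
    intro T τ τS hτS q hq₁ hq₂
    -- the slice point `τ̃ = (τ, s π τ)`
    have hτπ : (τ ≫ σX.left) ≫ (𝒳 ⊗ 𝒳).hom = τS ≫ S₀.ι := by rw [Category.assoc, hσXS, hτS]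
    have hβ₁τ : (τ ≫ σX.left) ≫ β₁ = τS ≫ qu ≫ L'.dom.ι := by
      refine hextV _ _ ?_ ?_
      · simp only [Category.assoc]
        rw [hβ₁1, reassoc_of% hσX2, hqu₁, reassoc_of% hτS]
      · simp only [Category.assoc]
        rw [hβ₁2, reassoc_of% hσXS, hqu₂, reassoc_of% hτS]
    obtain ⟨ℓ₁, hℓ₁⟩ : ∃ ℓ₁ : T ⟶ (U₁ : Scheme.{u}), ℓ₁ ≫ U₁.ι = τ ≫ σX.left := by
      refine exists_lift_opens U₁ _ fun p => ⟨?_, ?_⟩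
      · change β₁.base ((τ ≫ σX.left).base p) ∈ L'.dom
        rw [base_comp_apply hβ₁τ]
        exact (qu.base (τS.base p)).2
      · change (𝒳 ⊗ 𝒳).hom.base ((τ ≫ σX.left).base p) ∈ S₀
        rw [base_comp_apply hτπ]
        exact (τS.base p).2
    have hℓ₁q : ℓ₁ ≫ q₁ = τS ≫ qu := by
      rw [← cancel_mono L'.dom.ι, Category.assoc, hq₁', ← Category.assoc, hℓ₁, hβ₁τ, Category.assoc]
    have hℓ₁π : ℓ₁ ≫ πS = τS := by
      rw [← cancel_mono S₀.ι, Category.assoc, hπS, ← Category.assoc, hℓ₁, hτπ]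
    have hβ₂ℓ : ℓ₁ ≫ β₂ = q ≫ L'.dom.ι := by
      refine hextV _ _ ?_ ?_
      · simp only [Category.assoc]
        rw [hβ₂1, reassoc_of% hℓ₁, reassoc_of% hσX1, hq₁]
      · simp only [Category.assoc]
        rw [hβ₂2, reassoc_of% hℓ₁q, hq₂]
    obtain ⟨ℓ₂, hℓ₂⟩ : ∃ ℓ₂ : T ⟶ (U₂ : Scheme.{u}), ℓ₂ ≫ U₂.ι = ℓ₁ := by
      refine exists_lift_opens U₂ _ fun p => ?_
      change β₂.base (ℓ₁.base p) ∈ L'.dom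
      rw [base_comp_apply hβ₂ℓ]
      exact (q.base p).2
    have hℓ₂q : ℓ₂ ≫ q₂ = q := by
      rw [← cancel_mono L'.dom.ι, Category.assoc, hq₂', ← Category.assoc, hℓ₂, hβ₂ℓ]
    have hβ₃ℓ : ℓ₂ ≫ β₃ = q ≫ Ψ' := by
      refine hextV _ _ ?_ ?_
      · simp only [Category.assoc]
        rw [hβ₃1, reassoc_of% hℓ₂q, hΨ1]
      · simp only [Category.assoc]
        rw [hβ₃2, reassoc_of% hℓ₂, reassoc_of% hℓ₁π, hΨ2, hq₂]
    obtain ⟨ℓ₃, hℓ₃⟩ : ∃ ℓ₃ : T ⟶ (U₃ : Scheme.{u}), ℓ₃ ≫ U₃.ι = ℓ₂ := by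
      refine exists_lift_opens U₃ _ fun p => ?_
      change β₃.base (ℓ₂.base p) ∈ Ψ'.opensRange
      rw [base_comp_apply hβ₃ℓ]
      exact ⟨q.base p, rfl⟩
    have hℓ₃θ : ℓ₃ ≫ θ = q := by
      rw [← cancel_mono Ψ', Category.assoc, hθ, ← Category.assoc, hℓ₃, hβ₃ℓ]
    refine ⟨ℓ₃, ?_, hℓ₃θ, ?_, ?_⟩
    · rw [hχ, ← Category.assoc, hℓ₃, ← Category.assoc, hℓ₂, hℓ₁]
    · rw [← Category.assoc, hℓ₃, ← Category.assoc, hℓ₂, hℓ₁q]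
    · rw [← Category.assoc, hℓ₃, hℓ₂q]
  -- ### Step E: the base point lies in the chart domain
  obtain ⟨ℓ₀, hℓ₀χ, -, -, -⟩ := factor τ τS hτS q hq₁ hq₂
  have hx : σX.left.base (τ.base x₀) ∈ χ.opensRange := ⟨ℓ₀.base x₀, base_comp_apply hℓ₀χ x₀⟩
  -- ### Step F: the agreement open `W₀ = {d ∈ A, (a,b) ∈ dom, (d·s′, y) ∈ dom′, (j(ab), y) ∈ dom′}`
  set W₀a : (U₃ : Scheme.{u}).Opens := d ⁻¹ᵁ A ⊓ χ ⁻¹ᵁ L.dom with hW₀adef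
  obtain ⟨dA, hdA⟩ : ∃ dA : (W₀a : Scheme.{u}) ⟶ (A : Scheme.{u}), dA ≫ A.ι = W₀a.ι ≫ d :=
    exists_lift_opens A (W₀a.ι ≫ d) fun w => w.2.1
  obtain ⟨qL, hqL⟩ : ∃ qL : (W₀a : Scheme.{u}) ⟶ (L.dom : Scheme.{u}), qL ≫ L.dom.ι = W₀a.ι ≫ χ :=
    exists_lift_opens L.dom (W₀a.ι ≫ χ) fun w => w.2.2
  -- `ρ (dA) = d·s′` and `j(ab)` as `W₀a`-points of `𝒱`, paired with `y`
  have hyW : (W₀a.ι ≫ χ ≫ (𝒳 ⊗ 𝒳).hom ≫ y) ≫ 𝒱.hom = W₀a.ι ≫ χ ≫ (𝒳 ⊗ 𝒳).hom := by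
    simp only [Category.assoc]
    rw [hy, Category.comp_id]
  obtain ⟨m₅, hm₅1, hm₅2⟩ : ∃ m₅ : (W₀a : Scheme.{u}) ⟶ (𝒱 ⊗ 𝒱).left,
      m₅ ≫ (fst 𝒱 𝒱).left = dA ≫ ρ ∧ m₅ ≫ (snd 𝒱 𝒱).left = W₀a.ι ≫ χ ≫ (𝒳 ⊗ 𝒳).hom ≫ y := by
    have w : (dA ≫ ρ) ≫ 𝒱.hom = (W₀a.ι ≫ χ ≫ (𝒳 ⊗ 𝒳).hom ≫ y) ≫ 𝒱.hom := by
      rw [hyW, Category.assoc, hρS, reassoc_of% hdA, hdS]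
    exact ⟨pullback.lift _ _ w, pullback.lift_fst _ _ _, pullback.lift_snd _ _ _⟩
  obtain ⟨m₆, hm₆1, hm₆2⟩ : ∃ m₆ : (W₀a : Scheme.{u}) ⟶ (𝒱 ⊗ 𝒱).left,
      m₆ ≫ (fst 𝒱 𝒱).left = qL ≫ L.mul ≫ j.left ∧
      m₆ ≫ (snd 𝒱 𝒱).left = W₀a.ι ≫ χ ≫ (𝒳 ⊗ 𝒳).hom ≫ y := by
    have w : (qL ≫ L.mul ≫ j.left) ≫ 𝒱.hom = (W₀a.ι ≫ χ ≫ (𝒳 ⊗ 𝒳).hom ≫ y) ≫ 𝒱.hom := by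
      rw [hyW, Category.assoc, Category.assoc, hjS, L.mul_comp, reassoc_of% hqL]
    exact ⟨pullback.lift _ _ w, pullback.lift_fst _ _ _, pullback.lift_snd _ _ _⟩
  set W₀ : (W₀a : Scheme.{u}).Opens := m₅ ⁻¹ᵁ L'.dom ⊓ m₆ ⁻¹ᵁ L'.dom with hW₀def
  obtain ⟨Q₇, hQ₇⟩ : ∃ Q₇ : (W₀ : Scheme.{u}) ⟶ (L'.dom : Scheme.{u}), Q₇ ≫ L'.dom.ι = W₀.ι ≫ m₅ :=
    exists_lift_opens L'.dom (W₀.ι ≫ m₅) fun w => w.2.1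
  obtain ⟨Q₈, hQ₈⟩ : ∃ Q₈ : (W₀ : Scheme.{u}) ⟶ (L'.dom : Scheme.{u}), Q₈ ≫ L'.dom.ι = W₀.ι ≫ m₆ :=
    exists_lift_opens L'.dom (W₀.ι ≫ m₆) fun w => w.2.2
  -- the agreement open in `𝒳 ×_S 𝒳`
  obtain ⟨ω, hω⟩ : ∃ ω : (W₀ : Scheme.{u}) ⟶ (U₃ : Scheme.{u}), ω = W₀.ι ≫ W₀a.ι := ⟨_, rfl⟩
  haveI hωo : IsOpenImmersion (ω ≫ χ) := by rw [hω]; infer_instance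
  set W : (𝒳 ⊗ 𝒳).left.Opens := (ω ≫ χ).opensRange with hWdef
  have hWl : W ≤ L.dom := by
    rintro _ ⟨w, rfl⟩
    change χ.base (ω.base w) ∈ L.dom
    rw [hω]
    exact (W₀.ι.base w).2.2
  have hWr : W ≤ χ.opensRange := by
    rintro _ ⟨w, rfl⟩
    exact ⟨ω.base w, rfl⟩
  -- ### Step G: `W` is non-empty (the `T₁`-configuration of `hne`)
  have hWne : (W : Set ↑(𝒳 ⊗ 𝒳).left).Nonempty := by
    obtain ⟨T₁, ⟨x₁⟩, τ₁, τ₁S, q', qy, qa, qA, hτ₁S, hq'1, hq'2, hqa1, hqa2, hqA, hqy1, hqy2⟩ := hne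
    obtain ⟨ℓ, hℓχ, hℓθ, -, -⟩ := factor τ₁ τ₁S hτ₁S q' hq'1 hq'2
    have hℓd : ℓ ≫ d = τ₁ ≫ j.left := by rw [hd, reassoc_of% hℓθ, hq'1]
    have hτσ : τ₁ ≫ σX.left = qa ≫ L.dom.ι := by
      refine hextX _ _ ?_ ?_
      · rw [Category.assoc, hσX1, Category.comp_id, Category.assoc, hqa1]
      · rw [Category.assoc, hσX2, Category.assoc, hqa2]
    obtain ⟨ℓa, hℓa⟩ : ∃ ℓa : T₁ ⟶ (W₀a : Scheme.{u}), ℓa ≫ W₀a.ι = ℓ := by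
      refine exists_lift_opens W₀a ℓ fun p => ⟨?_, ?_⟩
      · change d.base (ℓ.base p) ∈ A
        rw [base_comp_apply hℓd, ← base_comp_apply hqA]
        exact (qA.base p).2
      · change χ.base (ℓ.base p) ∈ L.dom
        rw [base_comp_apply hℓχ, ← base_comp_apply hτσ.symm]
        exact (qa.base p).2
    have hℓadA : ℓa ≫ dA = qA := by
      rw [← cancel_mono A.ι, Category.assoc, hdA, reassoc_of% hℓa, hℓd, hqA]
    have hℓaqL : ℓa ≫ qL = qa := by
      rw [← cancel_mono L.dom.ι, Category.assoc, hqL, reassoc_of% hℓa, hℓχ, hτσ]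
    -- `ρ (qA) = j (a·s)`: both `e (qA)` and `φ (qa)` lift `σ′ (j a₁)`
    have hqAe : qA ≫ e = qa ≫ φ := by
      rw [← cancel_mono L'.dom.ι]
      refine hextV _ _ ?_ ?_
      · simp only [Category.assoc]
        rw [reassoc_of% he, hσ'1, Category.comp_id, hqA, reassoc_of% hφ₁, hjj1, reassoc_of% hqa1]
      · simp only [Category.assoc]
        rw [reassoc_of% he, hσ'2, reassoc_of% hqA, reassoc_of% hjS, reassoc_of% hφ₁, hjj2, reassoc_of% hqa2]
    have hρqA : qA ≫ ρ = qa ≫ L.mul ≫ j.left := by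
      rw [hρ, ← Category.assoc, hqAe, Category.assoc, hφ₂]
    have hm₅ℓ : ℓa ≫ m₅ = qy ≫ L'.dom.ι := by
      refine hextV _ _ ?_ ?_
      · simp only [Category.assoc]
        rw [hm₅1, reassoc_of% hℓadA, hρqA, hqy1]
      · simp only [Category.assoc]
        rw [hm₅2, reassoc_of% hℓa, reassoc_of% hℓχ, reassoc_of% hσXS, hqy2]
    have hm₆ℓ : ℓa ≫ m₆ = qy ≫ L'.dom.ι := by
      refine hextV _ _ ?_ ?_
      · simp only [Category.assoc]
        rw [hm₆1, reassoc_of% hℓaqL, hqy1]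
      · simp only [Category.assoc]
        rw [hm₆2, reassoc_of% hℓa, reassoc_of% hℓχ, reassoc_of% hσXS, hqy2]
    obtain ⟨ℓW, -⟩ : ∃ ℓW : T₁ ⟶ (W₀ : Scheme.{u}), ℓW ≫ W₀.ι = ℓa := by
      refine exists_lift_opens W₀ ℓa fun p => ⟨?_, ?_⟩
      · change m₅.base (ℓa.base p) ∈ L'.dom
        rw [base_comp_apply hm₅ℓ]
        exact (qy.base p).2
      · change m₆.base (ℓa.base p) ∈ L'.dom
        rw [base_comp_apply hm₆ℓ]
        exact (qy.base p).2
    exact ⟨(ω ≫ χ).base (ℓW.base x₁), ℓW.base x₁, rfl⟩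
  -- ### Step H: ASSOCIATIVITY twice + cancellation: `d·s′ = j(ab)` on `W₀`
  have assoc1 : Q₇ ≫ L'.mul = ω ≫ U₃.ι ≫ q₂ ≫ L'.mul := by
    refine L'.assoc (T := (W₀ : Scheme.{u}))
      (a := ω ≫ d) (b := ω ≫ χ ≫ (𝒳 ⊗ 𝒳).hom ≫ s ≫ j.left) (c := ω ≫ χ ≫ (𝒳 ⊗ 𝒳).hom ≫ y)
      (ab := W₀.ι ≫ dA ≫ ρ) (bc := ω ≫ U₃.ι ≫ U₂.ι ≫ πS ≫ qu ≫ L'.mul)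
      (abc := Q₇ ≫ L'.mul) (abc' := ω ≫ U₃.ι ≫ q₂ ≫ L'.mul)
      (q₁ := W₀.ι ≫ dA ≫ e) (q₂ := ω ≫ U₃.ι ≫ U₂.ι ≫ πS ≫ qu) (q₃ := Q₇) (q₄ := ω ≫ θ)
      ⟨?_, ?_, ?_⟩ ⟨?_, ?_, ?_⟩ ⟨?_, ?_, rfl⟩ ⟨?_, ?_, ?_⟩
    · simp only [Category.assoc]
      rw [reassoc_of% he, hσ'1, Category.comp_id, hdA, hω, Category.assoc]
    · simp only [Category.assoc]
      rw [reassoc_of% he, hσ'2, reassoc_of% hdA, reassoc_of% hdS, hω]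
      simp only [Category.assoc]
    · rw [hρ]
      simp only [Category.assoc]
    · simp only [Category.assoc]
      rw [hqu₁, reassoc_of% hπS, hχ]
      simp only [Category.assoc]
    · simp only [Category.assoc]
      rw [hqu₂, reassoc_of% hπS, hχ]
      simp only [Category.assoc]
    · simp only [Category.assoc]
    · rw [reassoc_of% hQ₇, hm₅1]
    · rw [reassoc_of% hQ₇, hm₅2, hω]
      simp only [Category.assoc]
    · rw [hd, Category.assoc]
    · rw [Category.assoc, hθ2]
    · rw [Category.assoc, hθ1]
  have assoc2 : Q₈ ≫ L'.mul = ω ≫ U₃.ι ≫ q₂ ≫ L'.mul := by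
    refine L'.assoc (T := (W₀ : Scheme.{u}))
      (a := ω ≫ χ ≫ (fst 𝒳 𝒳).left ≫ j.left) (b := ω ≫ χ ≫ (snd 𝒳 𝒳).left ≫ j.left)
      (c := ω ≫ χ ≫ (𝒳 ⊗ 𝒳).hom ≫ y)
      (ab := W₀.ι ≫ qL ≫ L.mul ≫ j.left) (bc := ω ≫ U₃.ι ≫ U₂.ι ≫ q₁ ≫ L'.mul)
      (abc := Q₈ ≫ L'.mul) (abc' := ω ≫ U₃.ι ≫ q₂ ≫ L'.mul)
      (q₁ := W₀.ι ≫ qL ≫ φ) (q₂ := ω ≫ U₃.ι ≫ U₂.ι ≫ q₁) (q₃ := Q₈) (q₄ := ω ≫ U₃.ι ≫ q₂)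
      ⟨?_, ?_, ?_⟩ ⟨?_, ?_, ?_⟩ ⟨?_, ?_, rfl⟩ ⟨?_, ?_, ?_⟩
    · simp only [Category.assoc]
      rw [reassoc_of% hφ₁, hjj1, reassoc_of% hqL, hω]
      simp only [Category.assoc]
    · simp only [Category.assoc]
      rw [reassoc_of% hφ₁, hjj2, reassoc_of% hqL, hω]
      simp only [Category.assoc]
    · simp only [Category.assoc]
      rw [hφ₂]
    · simp only [Category.assoc]
      rw [reassoc_of% hq₁', hβ₁1, hχ]
      simp only [Category.assoc]
    · simp only [Category.assoc]
      rw [reassoc_of% hq₁', hβ₁2, hχ]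
      simp only [Category.assoc]
    · simp only [Category.assoc]
    · rw [reassoc_of% hQ₈, hm₆1]
    · rw [reassoc_of% hQ₈, hm₆2, hω]
      simp only [Category.assoc]
    · simp only [Category.assoc]
      rw [reassoc_of% hq₂', hβ₂1, hχ]
      simp only [Category.assoc]
    · simp only [Category.assoc]
      rw [reassoc_of% hq₂', hβ₂2]
    · simp only [Category.assoc]
  have hQ78 : Q₇ = Q₈ := by
    rw [← cancel_mono Ψ']
    refine hextV _ _ ?_ ?_
    · rw [Category.assoc, Category.assoc, hΨ1, assoc1, assoc2]
    · rw [Category.assoc, Category.assoc, hΨ2, reassoc_of% hQ₇, reassoc_of% hQ₈, hm₅2, hm₆2]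
  have hassoc : W₀.ι ≫ dA ≫ ρ = W₀.ι ≫ qL ≫ L.mul ≫ j.left := by
    rw [← hm₅1, ← reassoc_of% hQ₇, hQ78, reassoc_of% hQ₈, hm₆1]
  -- ### Step I: the chart as a partial map, and the agreement on `W`
  set g' : (𝒳 ⊗ 𝒳).left.PartialMap 𝒲.left :=
    ⟨χ.opensRange, dense_of_nonempty _ ⟨_, hx⟩, χ.isoOpensRange.inv ≫ d ≫ i₂.left⟩ with hg'def
  refine RationalMap.mem_domain_of_agree_on_nonempty_open
    (⟨L.dom, L.dense_dom.dense, L.mul ≫ (j ≫ i₁).left⟩ : (𝒳 ⊗ 𝒳).left.PartialMap 𝒲.left) rfl g' hx W hWne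
    hWl hWr ?_
  let Ω := (ω ≫ χ).isoOpensRange
  have hΩ : Ω.hom ≫ W.ι = ω ≫ χ := Scheme.Hom.isoOpensRange_hom_ι _
  have hL : Ω.hom ≫ (𝒳 ⊗ 𝒳).left.homOfLE hWl = W₀.ι ≫ qL := by
    rw [← cancel_mono L.dom.ι, Category.assoc, Scheme.homOfLE_ι, hΩ, Category.assoc, hqL, hω, Category.assoc]
  have hR : Ω.hom ≫ (𝒳 ⊗ 𝒳).left.homOfLE hWr ≫ χ.isoOpensRange.inv = ω := by
    rw [← cancel_mono χ, Category.assoc, Category.assoc, Scheme.Hom.isoOpensRange_inv_comp, Scheme.homOfLE_ι, hΩ]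
  have hR' : Ω.hom ≫ (𝒳 ⊗ 𝒳).left.homOfLE hWr ≫ χ.isoOpensRange.inv ≫ d ≫ i₂.left = ω ≫ d ≫ i₂.left := by
    have h := congrArg (· ≫ d ≫ i₂.left) hR
    simpa only [Category.assoc] using h
  rw [← cancel_epi Ω.hom]
  change Ω.hom ≫ (𝒳 ⊗ 𝒳).left.homOfLE hWl ≫ L.mul ≫ (j ≫ i₁).left =
    Ω.hom ≫ (𝒳 ⊗ 𝒳).left.homOfLE hWr ≫ χ.isoOpensRange.inv ≫ d ≫ i₂.left
  rw [reassoc_of% hL, hR', Over.comp_left, hω, Category.assoc, ← reassoc_of% hdA, ← hglue,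
    ← reassoc_of% hassoc]

end Literature.AlgebraicGeometry.GroupSchemes

end
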